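import Summits.AtomisticToContinuum.Crystallization.Theorems.ExcessDecayLiouvilleLinearisation

/-!
# Route `ExcessDecayLiouville`: the force-constant map is Lipschitz in the bond, `‖K(e+a) − K(e)‖ ≲ |e|⁻⁹|a|`

Far-field summation-by-parts ingredient of the linear interior-decay estimate for item `ExcessDecay`
(stmt-AtomisticToContinuum-9334), harmonic-replacement architecture: moving one lattice difference from the
displacement onto the kernel gains a factor `|e|⁻¹` in the far field, because
`K(e)w = h(|e|²)w + 2⟪e,w⟫h′(|e|²)e` (`h(x) = −x⁻⁷ + x⁻⁴`) is smooth in the bond `e` with derivative `O(|e|⁻⁹)`: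

* `forceConst_shift_identity` : the algebraic decomposition of `K(e+a)w − K(e)w` into four pieces;
* `shifted_bond_bounds` : `|e+a|² ≥ (9/16)|e|²`, `||e+a|² − |e|²| ≤ (9/4)|e||a|`, `|e+a| ≤ (5/4)|e|` for `|a| ≤ |e|/4`;
* `klipschitz_scalar_bound` : the scalar bookkeeping;
* `norm_forceConst_shift_sub_le` : `‖K(e+a)w − K(e)w‖ ≤ 200000 · |e|⁻⁹ · |a| · |w|` for `|e| ≥ 9/10`, `|a| ≤ |e|/4`.

All `[folklore]`; helper lemmas, nothing here closes an item.
-/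

noncomputable section

namespace Summit.AtomisticToContinuum.Crystallization.Theorems.ExcessDecayLiouville

open scoped BigOperators Topology InnerProductSpace RealInnerProductSpace
open Literature.MathematicalPhysics.StatisticalMechanics
open Summit.AtomisticToContinuum.Crystallization.Theorems.PhononStabilityNegative

-- Local notation: the force-constant map `K(e)w = h(|e|²)w + 2⟪e,w⟫h′(|e|²)e`.
local notation3 "𝕂[" e "] " w:max =>
  (-((‖e‖ ^ 2)⁻¹) ^ 7 + ((‖e‖ ^ 2)⁻¹) ^ 4) • w + (2 * ⟪e, w⟫ * (7 * ((‖e‖ ^ 2)⁻¹) ^ 8 - 4 * ((‖e‖ ^ 2)⁻¹) ^ 5)) • e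

/-- The four-piece decomposition of `K(e+a)w − K(e)w` (generic profile functions `hh`, `hh′`). [folklore] -/
theorem forceConst_shift_identity (e a w : EuclideanSpace ℝ (Fin 3)) (hh hh' : ℝ → ℝ) :
    hh (‖e + a‖ ^ 2) • w + (2 * ⟪e + a, w⟫ * hh' (‖e + a‖ ^ 2)) • (e + a) -
        (hh (‖e‖ ^ 2) • w + (2 * ⟪e, w⟫ * hh' (‖e‖ ^ 2)) • e) =
      (hh (‖e + a‖ ^ 2) - hh (‖e‖ ^ 2)) • w + (2 * ⟪a, w⟫ * hh' (‖e + a‖ ^ 2)) • (e + a) +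
        (2 * ⟪e, w⟫ * (hh' (‖e + a‖ ^ 2) - hh' (‖e‖ ^ 2))) • (e + a) + (2 * ⟪e, w⟫ * hh' (‖e‖ ^ 2)) • a := by
  rw [inner_add_left]
  module

/-- Geometry of a shifted far bond: for `|a| ≤ |e|/4`, `|e+a|² ≥ (9/16)|e|²`, `||e+a|² − |e|²| ≤ (9/4)|e||a|`,
`|e+a| ≤ (5/4)|e|`. [folklore] -/
theorem shifted_bond_bounds {e a : EuclideanSpace ℝ (Fin 3)} (ha : ‖a‖ ≤ ‖e‖ / 4) :
    9 / 16 * ‖e‖ ^ 2 ≤ ‖e + a‖ ^ 2 ∧ |‖e + a‖ ^ 2 - ‖e‖ ^ 2| ≤ 9 / 4 * ‖e‖ * ‖a‖ ∧ ‖e + a‖ ≤ 5 / 4 * ‖e‖ := by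
  have ha0 : 0 ≤ ‖a‖ := norm_nonneg a
  have he0 : 0 ≤ ‖e‖ := norm_nonneg e
  have hcs : |⟪e, a⟫| ≤ ‖e‖ * ‖a‖ := abs_real_inner_le_norm e a
  have hsq : ‖e + a‖ ^ 2 = ‖e‖ ^ 2 + 2 * ⟪e, a⟫ + ‖a‖ ^ 2 := norm_add_sq_real e a
  have h1 := (abs_le.1 hcs).1
  have h2 := (abs_le.1 hcs).2
  refine ⟨?_, ?_, ?_⟩
  · rw [hsq]; nlinarith
  · rw [hsq, abs_le]; constructor <;> nlinarith
  · calc ‖e + a‖ ≤ ‖e‖ + ‖a‖ := norm_add_le e a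
      _ ≤ 5 / 4 * ‖e‖ := by linarith

/-- The scalar bookkeeping behind `norm_forceConst_shift_sub_le`: with `E = |e| ≥ 9/10` and `m = (9/16)E²`,
`(27/4)E(7m⁻⁸ + 4m⁻⁵) + (45/8)E³(56m⁻⁹ + 20m⁻⁶) ≤ 200000 E⁻⁹`. [folklore] -/
theorem klipschitz_scalar_bound {E : ℝ} (hE : 9 / 10 ≤ E) :
    27 / 4 * E * (7 * ((9 / 16 * E ^ 2)⁻¹) ^ 8 + 4 * ((9 / 16 * E ^ 2)⁻¹) ^ 5) +
        45 / 8 * E ^ 3 * (56 * ((9 / 16 * E ^ 2)⁻¹) ^ 9 + 20 * ((9 / 16 * E ^ 2)⁻¹) ^ 6) ≤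
      200000 * (E⁻¹) ^ 9 := by
  have hE0 : 0 < E := by linarith
  have hmi : (9 / 16 * E ^ 2)⁻¹ = (16 / 9) * (E⁻¹) ^ 2 := by rw [mul_inv, inv_pow]; norm_num
  rw [hmi]
  set u := E⁻¹ with hu
  have hu0 : 0 < u := inv_pos.2 hE0
  have hue : u * E = 1 := by rw [hu, inv_mul_cancel₀ hE0.ne']
  have hei : u ≤ 10 / 9 := by
    rw [hu, inv_le_comm₀ hE0 (by norm_num)]; linarith
  have hu15 : u ^ 15 ≤ (10 / 9) ^ 6 * u ^ 9 := by
    have : u ^ 6 ≤ (10 / 9) ^ 6 := pow_le_pow_left₀ hu0.le hei 6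
    nlinarith [pow_pos hu0 9]
  have e16 : ((16 / 9 : ℝ) * u ^ 2) ^ 8 * E = (16 / 9) ^ 8 * u ^ 15 := by
    have : u ^ 16 * E = u ^ 15 * (u * E) := by ring
    rw [mul_pow, ← pow_mul, show 2 * 8 = 16 by norm_num, mul_assoc, this, hue, mul_one]
  have e10 : ((16 / 9 : ℝ) * u ^ 2) ^ 5 * E = (16 / 9) ^ 5 * u ^ 9 := by
    have : u ^ 10 * E = u ^ 9 * (u * E) := by ring
    rw [mul_pow, ← pow_mul, show 2 * 5 = 10 by norm_num, mul_assoc, this, hue, mul_one]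
  have e18 : ((16 / 9 : ℝ) * u ^ 2) ^ 9 * E ^ 3 = (16 / 9) ^ 9 * u ^ 15 := by
    have : u ^ 18 * E ^ 3 = u ^ 15 * (u * E) ^ 3 := by ring
    rw [mul_pow, ← pow_mul, show 2 * 9 = 18 by norm_num, mul_assoc, this, hue, one_pow, mul_one]
  have e12 : ((16 / 9 : ℝ) * u ^ 2) ^ 6 * E ^ 3 = (16 / 9) ^ 6 * u ^ 9 := by
    have : u ^ 12 * E ^ 3 = u ^ 9 * (u * E) ^ 3 := by ring
    rw [mul_pow, ← pow_mul, show 2 * 6 = 12 by norm_num, mul_assoc, this, hue, one_pow, mul_one]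
  calc 27 / 4 * E * (7 * ((16 / 9) * u ^ 2) ^ 8 + 4 * ((16 / 9) * u ^ 2) ^ 5) +
        45 / 8 * E ^ 3 * (56 * ((16 / 9) * u ^ 2) ^ 9 + 20 * ((16 / 9) * u ^ 2) ^ 6)
      = 27 / 4 * (7 * ((((16 / 9) : ℝ) * u ^ 2) ^ 8 * E) + 4 * ((((16 / 9) : ℝ) * u ^ 2) ^ 5 * E)) +
          45 / 8 * (56 * ((((16 / 9) : ℝ) * u ^ 2) ^ 9 * E ^ 3) + 20 * ((((16 / 9) : ℝ) * u ^ 2) ^ 6 * E ^ 3)) := by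
        ring
    _ = 27 / 4 * (7 * ((16 / 9) ^ 8 * u ^ 15) + 4 * ((16 / 9) ^ 5 * u ^ 9)) +
          45 / 8 * (56 * ((16 / 9) ^ 9 * u ^ 15) + 20 * ((16 / 9) ^ 6 * u ^ 9)) := by rw [e16, e10, e18, e12]
    _ ≤ 27 / 4 * (7 * ((16 / 9) ^ 8 * ((10 / 9) ^ 6 * u ^ 9)) + 4 * ((16 / 9) ^ 5 * u ^ 9)) +
          45 / 8 * (56 * ((16 / 9) ^ 9 * ((10 / 9) ^ 6 * u ^ 9)) + 20 * ((16 / 9) ^ 6 * u ^ 9)) := by gcongr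
    _ = (27 / 4 * (7 * (16 / 9) ^ 8 * (10 / 9) ^ 6 + 4 * (16 / 9) ^ 5) +
          45 / 8 * (56 * (16 / 9) ^ 9 * (10 / 9) ^ 6 + 20 * (16 / 9) ^ 6)) * u ^ 9 := by ring
    _ ≤ 200000 * u ^ 9 := by gcongr; norm_num

/-- **The force-constant map is Lipschitz in the bond in the far field**: for `|e| ≥ 9/10` and a shift
`|a| ≤ |e|/4`, `‖K(e+a)w − K(e)w‖ ≤ 200000 · |e|⁻⁹ · |a| · |w|`. [folklore] -/
theorem norm_forceConst_shift_sub_le {e a : EuclideanSpace ℝ (Fin 3)} (he : 9 / 10 ≤ ‖e‖) (ha : ‖a‖ ≤ ‖e‖ / 4)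
    (w : EuclideanSpace ℝ (Fin 3)) :
    ‖𝕂[e + a] w - 𝕂[e] w‖ ≤ 200000 * (‖e‖⁻¹) ^ 9 * ‖a‖ * ‖w‖ := by
  have hid := forceConst_shift_identity e a w (fun y => -(y⁻¹) ^ 7 + (y⁻¹) ^ 4)
    (fun y => 7 * (y⁻¹) ^ 8 - 4 * (y⁻¹) ^ 5)
  rw [hid]
  have he0 : 0 < ‖e‖ := by linarith
  have ha0 : 0 ≤ ‖a‖ := norm_nonneg a
  have hw0 : 0 ≤ ‖w‖ := norm_nonneg w
  obtain ⟨hyx, hdiff, hea⟩ := shifted_bond_bounds ha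
  set x := ‖e‖ ^ 2 with hx
  set y := ‖e + a‖ ^ 2 with hy
  have hm0 : 0 < 9 / 16 * ‖e‖ ^ 2 := by positivity
  have hmx : 9 / 16 * ‖e‖ ^ 2 ≤ x := by rw [hx]; nlinarith
  -- the profile bounds
  have hD := abs_h_sub_h_le hm0 hmx hyx
  have hD' := abs_h'_sub_h'_le hm0 hmx hyx
  set M := (9 / 16 * ‖e‖ ^ 2)⁻¹ with hM
  have hM0 : 0 < M := inv_pos.2 hm0
  have hyinv : y⁻¹ ≤ M := by rw [hM]; exact inv_anti₀ hm0 hyx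
  have hxinv : x⁻¹ ≤ M := by rw [hM]; exact inv_anti₀ hm0 hmx
  have hy0 : 0 < y := lt_of_lt_of_le hm0 hyx
  have hx0' : 0 < x := lt_of_lt_of_le hm0 hmx
  have hyinv0 : 0 ≤ y⁻¹ := by positivity
  have hxinv0 : 0 ≤ x⁻¹ := by positivity
  have hh'y : |7 * (y⁻¹) ^ 8 - 4 * (y⁻¹) ^ 5| ≤ 7 * M ^ 8 + 4 * M ^ 5 := by
    have h8 : (y⁻¹) ^ 8 ≤ M ^ 8 := pow_le_pow_left₀ hyinv0 hyinv 8
    have h5 : (y⁻¹) ^ 5 ≤ M ^ 5 := pow_le_pow_left₀ hyinv0 hyinv 5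
    have h8' : 0 ≤ (y⁻¹) ^ 8 := by positivity
    have h5' : 0 ≤ (y⁻¹) ^ 5 := by positivity
    exact abs_le.2 ⟨by nlinarith, by nlinarith⟩
  have hh'x : |7 * (x⁻¹) ^ 8 - 4 * (x⁻¹) ^ 5| ≤ 7 * M ^ 8 + 4 * M ^ 5 := by
    have h8 : (x⁻¹) ^ 8 ≤ M ^ 8 := pow_le_pow_left₀ hxinv0 hxinv 8
    have h5 : (x⁻¹) ^ 5 ≤ M ^ 5 := pow_le_pow_left₀ hxinv0 hxinv 5
    have h8' : 0 ≤ (x⁻¹) ^ 8 := by positivity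
    have h5' : 0 ≤ (x⁻¹) ^ 5 := by positivity
    exact abs_le.2 ⟨by nlinarith, by nlinarith⟩
  have hiaw : |⟪a, w⟫| ≤ ‖a‖ * ‖w‖ := abs_real_inner_le_norm a w
  have hiew : |⟪e, w⟫| ≤ ‖e‖ * ‖w‖ := abs_real_inner_le_norm e w
  have hA0 : 0 ≤ 7 * M ^ 8 + 4 * M ^ 5 := by positivity
  have hB0 : 0 ≤ 56 * M ^ 9 + 20 * M ^ 6 := by positivity
  -- the four pieces
  have n1 : ‖((-(y⁻¹) ^ 7 + (y⁻¹) ^ 4) - (-(x⁻¹) ^ 7 + (x⁻¹) ^ 4)) • w‖ ≤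
      (7 * M ^ 8 + 4 * M ^ 5) * (9 / 4 * ‖e‖ * ‖a‖) * ‖w‖ := by
    rw [norm_smul, Real.norm_eq_abs]
    refine mul_le_mul_of_nonneg_right (hD.trans ?_) hw0
    exact mul_le_mul_of_nonneg_left hdiff hA0
  have n2 : ‖(2 * ⟪a, w⟫ * (7 * (y⁻¹) ^ 8 - 4 * (y⁻¹) ^ 5)) • (e + a)‖ ≤
      2 * (‖a‖ * ‖w‖) * (7 * M ^ 8 + 4 * M ^ 5) * (5 / 4 * ‖e‖) := by
    rw [norm_smul, Real.norm_eq_abs, abs_mul, abs_mul, abs_two]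
    gcongr
  have n3 : ‖(2 * ⟪e, w⟫ * ((7 * (y⁻¹) ^ 8 - 4 * (y⁻¹) ^ 5) - (7 * (x⁻¹) ^ 8 - 4 * (x⁻¹) ^ 5))) • (e + a)‖ ≤
      2 * (‖e‖ * ‖w‖) * ((56 * M ^ 9 + 20 * M ^ 6) * (9 / 4 * ‖e‖ * ‖a‖)) * (5 / 4 * ‖e‖) := by
    rw [norm_smul, Real.norm_eq_abs, abs_mul, abs_mul, abs_two]
    have : |(7 * (y⁻¹) ^ 8 - 4 * (y⁻¹) ^ 5) - (7 * (x⁻¹) ^ 8 - 4 * (x⁻¹) ^ 5)| ≤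
        (56 * M ^ 9 + 20 * M ^ 6) * (9 / 4 * ‖e‖ * ‖a‖) := hD'.trans (mul_le_mul_of_nonneg_left hdiff hB0)
    gcongr
  have n4 : ‖(2 * ⟪e, w⟫ * (7 * (x⁻¹) ^ 8 - 4 * (x⁻¹) ^ 5)) • a‖ ≤
      2 * (‖e‖ * ‖w‖) * (7 * M ^ 8 + 4 * M ^ 5) * ‖a‖ := by
    rw [norm_smul, Real.norm_eq_abs, abs_mul, abs_mul, abs_two]
    gcongr
  have hsum := (norm_add_le _ _).trans (add_le_add ((norm_add₃_le).trans (add_le_add (add_le_add n1 n2) n3)) n4)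
  refine hsum.trans ?_
  have hscal := klipschitz_scalar_bound he
  rw [← hM] at hscal
  have hpos : 0 ≤ ‖a‖ * ‖w‖ := by positivity
  have key : (7 * M ^ 8 + 4 * M ^ 5) * (9 / 4 * ‖e‖ * ‖a‖) * ‖w‖ +
      2 * (‖a‖ * ‖w‖) * (7 * M ^ 8 + 4 * M ^ 5) * (5 / 4 * ‖e‖) +
      2 * (‖e‖ * ‖w‖) * ((56 * M ^ 9 + 20 * M ^ 6) * (9 / 4 * ‖e‖ * ‖a‖)) * (5 / 4 * ‖e‖) +
      2 * (‖e‖ * ‖w‖) * (7 * M ^ 8 + 4 * M ^ 5) * ‖a‖ =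
      (27 / 4 * ‖e‖ * (7 * M ^ 8 + 4 * M ^ 5) + 45 / 8 * ‖e‖ ^ 3 * (56 * M ^ 9 + 20 * M ^ 6)) * (‖a‖ * ‖w‖) := by
    ring
  rw [key]
  calc (27 / 4 * ‖e‖ * (7 * M ^ 8 + 4 * M ^ 5) + 45 / 8 * ‖e‖ ^ 3 * (56 * M ^ 9 + 20 * M ^ 6)) * (‖a‖ * ‖w‖)
      ≤ 200000 * (‖e‖⁻¹) ^ 9 * (‖a‖ * ‖w‖) := mul_le_mul_of_nonneg_right hscal hpos
    _ = 200000 * (‖e‖⁻¹) ^ 9 * ‖a‖ * ‖w‖ := by ring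

end Summit.AtomisticToContinuum.Crystallization.Theorems.ExcessDecayLiouville

end
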